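import Summits.Ventures.LatticeQCDFlow.Scoring.PlaquetteAngleMomentBounds
import Summits.Ventures.LatticeQCDFlow.Scoring.U1TorusTopologicalSusceptibilityFiniteVolume
import Mathlib.Analysis.Real.Pi.Bounds
import Mathlib.Analysis.Complex.ExponentialBounds
import HarnessLib

/-!
# Weak-coupling law of the plaquette-angle second moment and of the `U(1)` topological susceptibility: `β·⟨v²⟩_β → 1`, `4π² β χ_∞(β) → 1`

HONEST FRAMING: exact (Metropolis-corrected) sampling algorithms for lattice gauge theory;
figures of merit are autocorrelation/cost numbers at stated couplings and volumes; no
continuum-physics claim.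

Venture `LatticeQCDFlow` (cell pub-lqcd), sub-topic `Scoring`; FANOUT row 5 (`s0-sun-a`), GEN-15.
NEW WORK of the cell (placement rule): the carried NOT-TYPED item "`χ_t` asymptotics (large `β`)".
`Scoring/U1TorusTopologicalSusceptibilityFiniteVolume.lean` identified the infinite-volume
topological susceptibility of 2-d `U(1)` with the second moment of ONE plaquette angle,
`χ_∞(β) = ⟨v²⟩_β/(4π²)`, `⟨v²⟩_β = ∫_{−π}^{π} v² e^{β cos v} dv / ∫_{−π}^{π} e^{β cos v} dv`, and proved
`|χ_t(L, β) − χ_∞(β)| ≤ (L²+3) e^{3β} (I₁/I₀)^{L²−3}/(4π²)`.  Here, from the integration-by-parts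
identities and the Gaussian sixth-moment bound of `Scoring/PlaquetteAngleMomentBounds.lean`
(`K = (9/10) e^{−3} π⁷ √π ≈ 239.9`):

* **`one_sub_exp_le_beta_mul_sqMoment`** — `1 − e^{−β}/I₀(β) ≤ β ⟨v²⟩_β` for `β > 0`
  (`v sin v ≤ v²` and `β⟨v sin v⟩ = 1 − e^{−β}/I₀`);
* **`sub_one_mul_sqMoment_le`** — `(β − 1) ⟨v²⟩_β ≤ I₁(β)/I₀(β) + K/β²` for `β ≥ 1`
  (`v² ≤ sin² v + v⁴/3`, `β⟨sin² v⟩ = I₁/I₀`, `v⁴ ≤ v³ sin v + v⁶/6`, `β⟨v³ sin v⟩ ≤ 3⟨v²⟩`,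
  `⟨v⁶⟩ ≤ 18K/β³`);
* **`tendsto_beta_mul_sqMoment`** — `β ⟨v²⟩_β → 1` as `β → ∞`;
* **`tendsto_beta_mul_chiInf`** — **`β · χ_∞(β) → 1/(4π²)`**: the weak-coupling (continuum-limit)
  law of the 2-d `U(1)` topological susceptibility in lattice units, for the tree's closed form
  `χ_∞(β) = 1/12 + κ_0(β)/(2π² I₀(β))`;
* **`abs_beta_mul_chiInf_sub_le`** — `|4π² β χ_∞(β) − 1| ≤ 2/β + 2K/β²` for `β ≥ 2`, and with the
  finite-volume law **`abs_beta_mul_u1TopSusceptibility_sub_le`** —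
  `|4π² β χ_t(L, β) − 1| ≤ 2/β + 2K/β² + β (L²+3) e^{3β} (I₁/I₀)^{L²−3}` for `L ≥ 2`, `β ≥ 2`;
  `weakCouplingConst_le` (`K ≤ 240`) gives the primed versions with `2/β + 480/β²`.

The kernel enclosures of `χ_∞` at `β = 1, …, 7` (`Scoring/U1TopSusceptibilityInfiniteVolumeEnclosures*.lean`)
are far sharper in that range (`4π²·7·χ_∞(7) = 1.0864…`); the content here is the limit and its
`O(1/β)` rate with explicit constants.  Elementary given the parents; nothing is cited.
No sampler values.
-/

noncomputable section

open Real MeasureTheory Set Filter Topology intervalIntegral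
open Literature.Analysis.FunctionSpaces

namespace Summit.Ventures.LatticeQCDFlow.Scoring

/-! ### 1. Two-sided bounds on the second moment -/

/-- **Lower bound**: `1 − e^{−β}/I₀(β) ≤ β ⟨v²⟩_β` for `β > 0`. -/
theorem one_sub_exp_le_beta_mul_sqMoment {β : ℝ} (hβ : 0 < β) :
    1 - Real.exp (-β) / besselI 0 β ≤
      β * (∫ v in (-π)..π, v ^ 2 * Real.exp (β * Real.cos v)) /
        (∫ v in (-π)..π, Real.exp (β * Real.cos v)) := by
  have hπ : 0 < π := Real.pi_pos
  have hle : -π ≤ π := by linarith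
  have hI0 : 0 < besselI 0 β := besselI_zero_pos β
  have hmono : ∫ v in (-π)..π, v * Real.sin v * Real.exp (β * Real.cos v) ≤
      ∫ v in (-π)..π, v ^ 2 * Real.exp (β * Real.cos v) := by
    refine intervalIntegral.integral_mono_on hle ?_ ?_ fun v _ => id_mul_sin_mul_exp_le β v
    · exact (by fun_prop : Continuous fun v => v * Real.sin v * Real.exp (β * Real.cos v))
        |>.intervalIntegrable _ _
    · exact (by fun_prop : Continuous fun v => v ^ 2 * Real.exp (β * Real.cos v)).intervalIntegrable _ _
  have h1 := beta_mul_integral_id_mul_sin_mul_exp β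
  rw [integral_exp_mul_cos_neg_pi_pi, le_div_iff₀ (by positivity)]
  have h2 : (1 - Real.exp (-β) / besselI 0 β) * (2 * π * besselI 0 β) =
      2 * π * besselI 0 β - 2 * π * Real.exp (-β) := by
    field_simp
  rw [h2]
  nlinarith [mul_le_mul_of_nonneg_left hmono hβ.le]

/-- `1 − e^{−β} ≤ β ⟨v²⟩_β` for `β > 0` (`I₀ ≥ 1`). -/
theorem one_sub_exp_le_beta_mul_sqMoment' {β : ℝ} (hβ : 0 < β) :
    1 - Real.exp (-β) ≤
      β * (∫ v in (-π)..π, v ^ 2 * Real.exp (β * Real.cos v)) /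
        (∫ v in (-π)..π, Real.exp (β * Real.cos v)) := by
  refine le_trans ?_ (one_sub_exp_le_beta_mul_sqMoment hβ)
  have h1 : Real.exp (-β) / besselI 0 β ≤ Real.exp (-β) :=
    div_le_self (Real.exp_pos _).le (one_le_besselI_zero β)
  linarith

/-- `∫ v² w_β ≤ 2π I₁(β)/β + (1/3) ∫ v⁴ w_β` for `β > 0` (`v² ≤ sin² v + v⁴/3`, `β ∫ sin² v w_β = 2π I₁`). -/
theorem sqMoment_le_besselI_add_fourthMoment {β : ℝ} (hβ : 0 < β) :
    ∫ v in (-π)..π, v ^ 2 * Real.exp (β * Real.cos v) ≤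
      2 * π * besselI 1 β / β + (∫ v in (-π)..π, v ^ 4 * Real.exp (β * Real.cos v)) / 3 := by
  have hle : -π ≤ π := by linarith [Real.pi_pos]
  have hc1 : Continuous fun v => Real.sin v ^ 2 * Real.exp (β * Real.cos v) := by fun_prop
  have hc2 : Continuous fun v => v ^ 4 * Real.exp (β * Real.cos v) / 3 := by fun_prop
  have hmono : ∫ v in (-π)..π, v ^ 2 * Real.exp (β * Real.cos v) ≤
      ∫ v in (-π)..π, (Real.sin v ^ 2 * Real.exp (β * Real.cos v) +
        v ^ 4 * Real.exp (β * Real.cos v) / 3) := by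
    refine intervalIntegral.integral_mono_on hle ?_ ((hc1.add hc2).intervalIntegrable _ _)
      fun v _ => ?_
    · exact (by fun_prop : Continuous fun v => v ^ 2 * Real.exp (β * Real.cos v)).intervalIntegrable _ _
    · have h := sq_le_sin_sq_add_pow_four v
      have hw := (Real.exp_pos (β * Real.cos v)).le
      nlinarith [mul_le_mul_of_nonneg_right h hw]
  rw [intervalIntegral.integral_add (hc1.intervalIntegrable _ _) (hc2.intervalIntegrable _ _),
    intervalIntegral.integral_div] at hmono
  have hS : ∫ v in (-π)..π, Real.sin v ^ 2 * Real.exp (β * Real.cos v) = 2 * π * besselI 1 β / β := by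
    rw [eq_div_iff hβ.ne', mul_comm, beta_mul_integral_sin_sq_mul_exp]
  linarith

/-- `∫ v⁴ w_β ≤ (3/β) ∫ v² w_β + (1/6) ∫ v⁶ w_β` for `β > 0` (`v⁴ ≤ v³ sin v + v⁶/6`,
`β ∫ v³ sin v w_β = 3 ∫ v² w_β − 2π³ e^{−β}`). -/
theorem fourthMoment_le_sqMoment_add_sixthMoment {β : ℝ} (hβ : 0 < β) :
    ∫ v in (-π)..π, v ^ 4 * Real.exp (β * Real.cos v) ≤
      3 / β * (∫ v in (-π)..π, v ^ 2 * Real.exp (β * Real.cos v)) +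
        (∫ v in (-π)..π, v ^ 6 * Real.exp (β * Real.cos v)) / 6 := by
  have hπ : 0 < π := Real.pi_pos
  have hle : -π ≤ π := by linarith
  have hc1 : Continuous fun v => v ^ 3 * Real.sin v * Real.exp (β * Real.cos v) := by fun_prop
  have hc2 : Continuous fun v => v ^ 6 * Real.exp (β * Real.cos v) / 6 := by fun_prop
  have hmono : ∫ v in (-π)..π, v ^ 4 * Real.exp (β * Real.cos v) ≤
      ∫ v in (-π)..π, (v ^ 3 * Real.sin v * Real.exp (β * Real.cos v) +
        v ^ 6 * Real.exp (β * Real.cos v) / 6) := by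
    refine intervalIntegral.integral_mono_on hle ?_ ((hc1.add hc2).intervalIntegrable _ _)
      fun v _ => ?_
    · exact (by fun_prop : Continuous fun v => v ^ 4 * Real.exp (β * Real.cos v)).intervalIntegrable _ _
    · have h := pow_four_le_cube_mul_sin_add_pow_six v
      have hw := (Real.exp_pos (β * Real.cos v)).le
      nlinarith [mul_le_mul_of_nonneg_right h hw]
  rw [intervalIntegral.integral_add (hc1.intervalIntegrable _ _) (hc2.intervalIntegrable _ _),
    intervalIntegral.integral_div] at hmono
  have hC := beta_mul_integral_cube_mul_sin_mul_exp β
  have hC' : ∫ v in (-π)..π, v ^ 3 * Real.sin v * Real.exp (β * Real.cos v) ≤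
      3 / β * ∫ v in (-π)..π, v ^ 2 * Real.exp (β * Real.cos v) := by
    rw [div_mul_eq_mul_div, le_div_iff₀ hβ, mul_comm _ β]
    have : 0 ≤ 2 * π ^ 3 * Real.exp (-β) := by positivity
    linarith
  linarith

/-- **Upper bound**: `(β − 1) ⟨v²⟩_β ≤ I₁(β)/I₀(β) + K/β²` for `β ≥ 1`, `K = (9/10) e^{−3} π⁷ √π`. -/
theorem sub_one_mul_sqMoment_le {β : ℝ} (hβ : 1 ≤ β) :
    (β - 1) * (∫ v in (-π)..π, v ^ 2 * Real.exp (β * Real.cos v)) /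
        (∫ v in (-π)..π, Real.exp (β * Real.cos v)) ≤
      besselI 1 β / besselI 0 β + 9 / 10 * Real.exp (-3) * π ^ 7 * Real.sqrt π / β ^ 2 := by
  have hβ0 : 0 < β := by linarith
  have hπ : 0 < π := Real.pi_pos
  have hI0 : 0 < besselI 0 β := besselI_zero_pos β
  have hZ := integral_exp_mul_cos_neg_pi_pi_pos β
  set M2 := ∫ v in (-π)..π, v ^ 2 * Real.exp (β * Real.cos v) with hM2
  set M4 := ∫ v in (-π)..π, v ^ 4 * Real.exp (β * Real.cos v) with hM4
  set M6 := ∫ v in (-π)..π, v ^ 6 * Real.exp (β * Real.cos v) with hM6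
  set Z := ∫ v in (-π)..π, Real.exp (β * Real.cos v) with hZd
  have h2 := sqMoment_le_besselI_add_fourthMoment hβ0
  have h4 := fourthMoment_le_sqMoment_add_sixthMoment hβ0
  have h6 := sixthMoment_plaquetteAngle_le hβ
  rw [← hM2, ← hM4] at h2
  rw [← hM2, ← hM4, ← hM6] at h4
  rw [← hM6, ← hZd] at h6
  -- `(β − 1) M2 ≤ 2π I₁ + β M6/18`
  have hM6Z : M6 ≤ 81 / 5 * Real.exp (-3) * π ^ 7 * Real.sqrt π / β ^ 3 * Z := (div_le_iff₀ hZ).1 h6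
  have key : (β - 1) * M2 ≤ 2 * π * besselI 1 β + β * M6 / 18 := by
    have h2' : β * M2 ≤ 2 * π * besselI 1 β + β * M4 / 3 := by
      have := mul_le_mul_of_nonneg_left h2 hβ0.le
      rwa [mul_add, mul_div_cancel₀ _ hβ0.ne', ← mul_div_assoc] at this
    have h4' : β * M4 / 3 ≤ M2 + β * M6 / 18 := by
      have := mul_le_mul_of_nonneg_left h4 (by positivity : (0 : ℝ) ≤ β / 3)
      have e1 : β / 3 * (3 / β * M2 + M6 / 6) = M2 + β * M6 / 18 := by
        field_simp
        ring
      rw [e1] at this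
      calc β * M4 / 3 = β / 3 * M4 := by ring
        _ ≤ _ := this
    linarith
  have hZeq : Z = 2 * π * besselI 0 β := by rw [hZd, integral_exp_mul_cos_neg_pi_pi]
  rw [div_le_iff₀ hZ]
  have eK : (besselI 1 β / besselI 0 β + 9 / 10 * Real.exp (-3) * π ^ 7 * Real.sqrt π / β ^ 2) * Z =
      2 * π * besselI 1 β + 9 / 10 * Real.exp (-3) * π ^ 7 * Real.sqrt π * Z / β ^ 2 := by
    rw [hZeq]
    field_simp
  rw [eK]
  have hM6' : β * M6 / 18 ≤ 9 / 10 * Real.exp (-3) * π ^ 7 * Real.sqrt π * Z / β ^ 2 := by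
    have := mul_le_mul_of_nonneg_left hM6Z (by positivity : (0 : ℝ) ≤ β / 18)
    calc β * M6 / 18 = β / 18 * M6 := by ring
      _ ≤ β / 18 * (81 / 5 * Real.exp (-3) * π ^ 7 * Real.sqrt π / β ^ 3 * Z) := this
      _ = 9 / 10 * Real.exp (-3) * π ^ 7 * Real.sqrt π * Z / β ^ 2 := by
          field_simp
          ring
  linarith [key]

/-- The upper bound in the form used for the limit: for `β ≥ 2`,
`β ⟨v²⟩_β ≤ (1 + 2/β)(1 + K/β²)` (`I₁ ≤ I₀`, `β/(β−1) ≤ 1 + 2/β`). -/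
theorem beta_mul_sqMoment_le {β : ℝ} (hβ : 2 ≤ β) :
    β * (∫ v in (-π)..π, v ^ 2 * Real.exp (β * Real.cos v)) /
        (∫ v in (-π)..π, Real.exp (β * Real.cos v)) ≤
      (1 + 2 / β) * (1 + 9 / 10 * Real.exp (-3) * π ^ 7 * Real.sqrt π / β ^ 2) := by
  have hβ0 : 0 < β := by linarith
  have hβ1 : 0 < β - 1 := by linarith
  have hZ := integral_exp_mul_cos_neg_pi_pi_pos β
  have h := sub_one_mul_sqMoment_le (by linarith : (1 : ℝ) ≤ β)
  have hI : besselI 1 β / besselI 0 β ≤ 1 :=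
    (div_le_one (besselI_zero_pos β)).2 (besselI_le_besselI_zero 1 β)
  set q := (∫ v in (-π)..π, v ^ 2 * Real.exp (β * Real.cos v)) /
      (∫ v in (-π)..π, Real.exp (β * Real.cos v)) with hq
  have hq0 : 0 ≤ q := div_nonneg (intervalIntegral.integral_nonneg (by linarith [Real.pi_pos])
    fun v _ => by positivity) hZ.le
  set K := 9 / 10 * Real.exp (-3) * π ^ 7 * Real.sqrt π with hK
  have hK0 : 0 ≤ K := by positivity
  rw [mul_div_assoc, ← hq] at h ⊢
  -- `(β − 1) q ≤ 1 + K/β²` and `β ≤ (1 + 2/β)(β − 1)` for `β ≥ 2`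
  have h1 : (β - 1) * q ≤ 1 + K / β ^ 2 := by linarith
  have h2 : β ≤ (1 + 2 / β) * (β - 1) := by
    rw [show (1 + 2 / β) * (β - 1) = β + 1 - 2 / β by field_simp; ring]
    have : 2 / β ≤ 1 := (div_le_one hβ0).2 hβ
    linarith
  have hpos : 0 ≤ 1 + K / β ^ 2 := by positivity
  calc β * q ≤ (1 + 2 / β) * (β - 1) * q := mul_le_mul_of_nonneg_right h2 hq0
    _ = (1 + 2 / β) * ((β - 1) * q) := by ring
    _ ≤ (1 + 2 / β) * (1 + K / β ^ 2) := mul_le_mul_of_nonneg_left h1 (by positivity)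

/-- **`β ⟨v²⟩_β → 1` as `β → ∞`.** -/
theorem tendsto_beta_mul_sqMoment :
    Tendsto (fun β : ℝ => β * (∫ v in (-π)..π, v ^ 2 * Real.exp (β * Real.cos v)) /
      (∫ v in (-π)..π, Real.exp (β * Real.cos v))) atTop (𝓝 1) := by
  set K := 9 / 10 * Real.exp (-3) * π ^ 7 * Real.sqrt π with hK
  -- lower envelope
  have hlo : Tendsto (fun β : ℝ => 1 - Real.exp (-β)) atTop (𝓝 1) := by
    have h := Real.tendsto_exp_neg_atTop_nhds_zero
    simpa using (tendsto_const_nhds (x := (1 : ℝ))).sub h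
  -- upper envelope
  have hinv : Tendsto (fun β : ℝ => β⁻¹) atTop (𝓝 0) := tendsto_inv_atTop_zero
  have hup : Tendsto (fun β : ℝ => (1 + 2 / β) * (1 + K / β ^ 2)) atTop (𝓝 1) := by
    have h1 : Tendsto (fun β : ℝ => 1 + 2 / β) atTop (𝓝 1) := by
      have := (hinv.const_mul 2).const_add 1
      simpa [div_eq_mul_inv] using this
    have h2 : Tendsto (fun β : ℝ => 1 + K / β ^ 2) atTop (𝓝 1) := by
      have := ((hinv.pow 2).const_mul K).const_add 1
      simpa [div_eq_mul_inv, inv_pow] using this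
    simpa using h1.mul h2
  refine tendsto_of_tendsto_of_tendsto_of_le_of_le' hlo hup ?_ ?_
  · filter_upwards [eventually_gt_atTop (0 : ℝ)] with β hβ using one_sub_exp_le_beta_mul_sqMoment' hβ
  · filter_upwards [eventually_ge_atTop (2 : ℝ)] with β hβ using beta_mul_sqMoment_le hβ

/-! ### 2. The `U(1)` topological susceptibility at weak coupling -/

/-- `4π² · β χ_∞(β) = β ⟨v²⟩_β` (`β > 0`), for the tree's closed form
`χ_∞(β) = 1/12 + κ_0(β)/(2π² I₀(β))`. -/
theorem four_pi_sq_mul_beta_mul_chiInf {β : ℝ} (hβ : 0 < β) :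
    4 * π ^ 2 * (β * (1 / 12 + (∑' m : ℤ, besselI m.natAbs β *
        ((-1 : ℝ) ^ ((0 : ℤ) + m) / (((0 : ℤ) + m : ℤ) : ℝ) ^ 2)) / (2 * π ^ 2 * besselI 0 β))) =
      β * (∫ v in (-π)..π, v ^ 2 * Real.exp (β * Real.cos v)) /
        (∫ v in (-π)..π, Real.exp (β * Real.cos v)) := by
  rw [chiInf_eq_single_plaquette hβ, integral_exp_mul_cos_neg_pi_pi]
  have hπ : (π : ℝ) ≠ 0 := Real.pi_pos.ne'
  have hI0 : besselI 0 β ≠ 0 := (besselI_zero_pos β).ne'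
  field_simp

/-- **Weak-coupling lower bound**: `1 − e^{−β} ≤ 4π² β χ_∞(β)` for `β > 0`. -/
theorem one_sub_exp_le_four_pi_sq_mul_beta_mul_chiInf {β : ℝ} (hβ : 0 < β) :
    1 - Real.exp (-β) ≤ 4 * π ^ 2 * (β * (1 / 12 + (∑' m : ℤ, besselI m.natAbs β *
        ((-1 : ℝ) ^ ((0 : ℤ) + m) / (((0 : ℤ) + m : ℤ) : ℝ) ^ 2)) / (2 * π ^ 2 * besselI 0 β))) := by
  rw [four_pi_sq_mul_beta_mul_chiInf hβ]
  exact one_sub_exp_le_beta_mul_sqMoment' hβ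

/-- **Weak-coupling upper bound**: `4π² β χ_∞(β) ≤ (1 + 2/β)(1 + K/β²)` for `β ≥ 2`,
`K = (9/10) e^{−3} π⁷ √π`. -/
theorem four_pi_sq_mul_beta_mul_chiInf_le {β : ℝ} (hβ : 2 ≤ β) :
    4 * π ^ 2 * (β * (1 / 12 + (∑' m : ℤ, besselI m.natAbs β *
        ((-1 : ℝ) ^ ((0 : ℤ) + m) / (((0 : ℤ) + m : ℤ) : ℝ) ^ 2)) / (2 * π ^ 2 * besselI 0 β))) ≤
      (1 + 2 / β) * (1 + 9 / 10 * Real.exp (-3) * π ^ 7 * Real.sqrt π / β ^ 2) := by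
  rw [four_pi_sq_mul_beta_mul_chiInf (by linarith)]
  exact beta_mul_sqMoment_le hβ

/-- **THE WEAK-COUPLING LAW OF THE TOPOLOGICAL SUSCEPTIBILITY: `β · χ_∞(β) → 1/(4π²)` as `β → ∞`.** -/
theorem tendsto_beta_mul_chiInf :
    Tendsto (fun β : ℝ => β * (1 / 12 + (∑' m : ℤ, besselI m.natAbs β *
        ((-1 : ℝ) ^ ((0 : ℤ) + m) / (((0 : ℤ) + m : ℤ) : ℝ) ^ 2)) / (2 * π ^ 2 * besselI 0 β)))
      atTop (𝓝 (1 / (4 * π ^ 2))) := by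
  have hπ : (0 : ℝ) < 4 * π ^ 2 := by positivity
  have h := tendsto_beta_mul_sqMoment.div_const (4 * π ^ 2)
  refine (h.congr' ?_)
  filter_upwards [eventually_gt_atTop (0 : ℝ)] with β hβ
  rw [← four_pi_sq_mul_beta_mul_chiInf hβ, mul_div_cancel_left₀ _ hπ.ne']

/-- **Explicit rate**: `|4π² β χ_∞(β) − 1| ≤ 2/β + 2K/β²` for `β ≥ 2`, `K = (9/10) e^{−3} π⁷ √π`
(`≈ 239.9`; so `2K ≤ 480`). -/
theorem abs_beta_mul_chiInf_sub_le {β : ℝ} (hβ : 2 ≤ β) :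
    |4 * π ^ 2 * (β * (1 / 12 + (∑' m : ℤ, besselI m.natAbs β *
        ((-1 : ℝ) ^ ((0 : ℤ) + m) / (((0 : ℤ) + m : ℤ) : ℝ) ^ 2)) / (2 * π ^ 2 * besselI 0 β))) - 1| ≤
      2 / β + 2 * (9 / 10 * Real.exp (-3) * π ^ 7 * Real.sqrt π) / β ^ 2 := by
  have hβ0 : 0 < β := by linarith
  set K := 9 / 10 * Real.exp (-3) * π ^ 7 * Real.sqrt π with hK
  have hK0 : 0 ≤ K := by positivity
  have hup := four_pi_sq_mul_beta_mul_chiInf_le hβ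
  have hlo := one_sub_exp_le_four_pi_sq_mul_beta_mul_chiInf hβ0
  rw [← hK] at hup
  rw [abs_le]
  constructor
  · -- `e^{−β} ≤ 1/β ≤ 2/β + 2K/β²`
    have h1 : Real.exp (-β) ≤ 1 / β := by
      rw [Real.exp_neg, one_div]
      exact inv_anti₀ hβ0 (by linarith [Real.add_one_le_exp β])
    have h2 : 1 / β ≤ 2 / β + 2 * K / β ^ 2 := by
      have : 0 ≤ 2 * K / β ^ 2 := by positivity
      have : 1 / β ≤ 2 / β := div_le_div_of_nonneg_right (by norm_num) hβ0.le
      linarith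
    linarith
  · -- `(1 + 2/β)(1 + K/β²) − 1 = 2/β + K/β² + 2K/β³ ≤ 2/β + 2K/β²`
    have h3 : (1 + 2 / β) * (1 + K / β ^ 2) = 1 + (2 / β + K / β ^ 2 + 2 * K / β ^ 3) := by ring
    have h4 : 2 * K / β ^ 3 ≤ K / β ^ 2 := by
      rw [div_le_div_iff₀ (by positivity) (by positivity)]
      have : K * β ^ 2 * 2 ≤ K * β ^ 2 * β := by
        have := mul_le_mul_of_nonneg_left hβ (by positivity : (0 : ℝ) ≤ K * β ^ 2)
        linarith
      nlinarith
    have h5 : K / β ^ 2 + 2 * K / β ^ 3 ≤ 2 * K / β ^ 2 := by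
      rw [show 2 * K / β ^ 2 = K / β ^ 2 + K / β ^ 2 by ring]
      linarith
    linarith

/-- **The constant**: `K = (9/10) e^{−3} π⁷ √π ≤ 240` (`π < 3.141593`, `√π < 1.77246`, `e³ > 20.0855`). -/
theorem weakCouplingConst_le : 9 / 10 * Real.exp (-3) * π ^ 7 * Real.sqrt π ≤ 240 := by
  have hπ : π ≤ 3.141593 := Real.pi_lt_d6.le
  have hsq : Real.sqrt π ≤ 1.77246 := by
    rw [Real.sqrt_le_left (by norm_num)]
    nlinarith
  have he3 : (20.0855 : ℝ) ≤ Real.exp 3 := by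
    have h1 : Real.exp 3 = Real.exp 1 ^ 3 := by
      rw [← Real.exp_nat_mul]; norm_num
    rw [h1]
    have h2 : (2.7182818283 : ℝ) ^ 3 ≤ Real.exp 1 ^ 3 :=
      pow_le_pow_left₀ (by norm_num) Real.exp_one_gt_d9.le 3
    exact le_trans (by norm_num) h2
  have he : Real.exp (-3) ≤ 1 / 20.0855 := by
    rw [Real.exp_neg, one_div]
    exact inv_anti₀ (by norm_num) he3
  calc 9 / 10 * Real.exp (-3) * π ^ 7 * Real.sqrt π
      ≤ 9 / 10 * (1 / 20.0855) * (3.141593 : ℝ) ^ 7 * 1.77246 := by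
        gcongr
    _ ≤ 240 := by norm_num

/-- **Explicit rate, numeric constants**: `|4π² β χ_∞(β) − 1| ≤ 2/β + 480/β²` for `β ≥ 2`. -/
theorem abs_beta_mul_chiInf_sub_le' {β : ℝ} (hβ : 2 ≤ β) :
    |4 * π ^ 2 * (β * (1 / 12 + (∑' m : ℤ, besselI m.natAbs β *
        ((-1 : ℝ) ^ ((0 : ℤ) + m) / (((0 : ℤ) + m : ℤ) : ℝ) ^ 2)) / (2 * π ^ 2 * besselI 0 β))) - 1| ≤
      2 / β + 480 / β ^ 2 := by
  refine (abs_beta_mul_chiInf_sub_le hβ).trans ?_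
  have hβ0 : 0 < β := by linarith
  have h := weakCouplingConst_le
  have : 2 * (9 / 10 * Real.exp (-3) * π ^ 7 * Real.sqrt π) / β ^ 2 ≤ 480 / β ^ 2 :=
    div_le_div_of_nonneg_right (by linarith) (by positivity)
  linarith

variable {L : ℕ} [NeZero L]

/-- **At finite volume**: for `L ≥ 2` and `β ≥ 2`, with `V = L²`, `t = I₁(β)/I₀(β)` and
`K = (9/10) e^{−3} π⁷ √π`,
`|4π² β χ_t(L, β) − 1| ≤ 2/β + 2K/β² + β (V+3) e^{3β} t^{V−3}` (the weak-coupling law plus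
the finite-volume law of `Scoring/U1TorusTopologicalSusceptibilityFiniteVolume.lean`). -/
theorem abs_beta_mul_u1TopSusceptibility_sub_le {β : ℝ} (hβ : 2 ≤ β) (hL : 2 ≤ L) :
    |4 * π ^ 2 * (β * u1TopSusceptibility L β) - 1| ≤
      2 / β + 2 * (9 / 10 * Real.exp (-3) * π ^ 7 * Real.sqrt π) / β ^ 2 +
        β * (((L : ℝ) ^ 2 + 3) * Real.exp (3 * β) * (besselI 1 β / besselI 0 β) ^ (L ^ 2 - 3)) := by
  have hβ0 : 0 < β := by linarith
  have hπ : 0 < π := Real.pi_pos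
  have hfv := abs_u1TopSusceptibility_sub_le hβ0 hL
  have hwc := abs_beta_mul_chiInf_sub_le hβ
  set c := 1 / 12 + (∑' m : ℤ, besselI m.natAbs β *
    ((-1 : ℝ) ^ ((0 : ℤ) + m) / (((0 : ℤ) + m : ℤ) : ℝ) ^ 2)) / (2 * π ^ 2 * besselI 0 β) with hc
  set B := ((L : ℝ) ^ 2 + 3) * Real.exp (3 * β) * (besselI 1 β / besselI 0 β) ^ (L ^ 2 - 3) with hB
  -- `|4π²β χ_t − 4π²β c| ≤ 4π²β · B/(4π²) = β B`
  have h1 : |4 * π ^ 2 * (β * u1TopSusceptibility L β) - 4 * π ^ 2 * (β * c)| ≤ β * B := by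
    have e : 4 * π ^ 2 * (β * u1TopSusceptibility L β) - 4 * π ^ 2 * (β * c) =
        (4 * π ^ 2 * β) * (u1TopSusceptibility L β - c) := by ring
    rw [e, abs_mul, abs_of_pos (by positivity : (0 : ℝ) < 4 * π ^ 2 * β)]
    calc 4 * π ^ 2 * β * |u1TopSusceptibility L β - c| ≤ 4 * π ^ 2 * β * (B / (4 * π ^ 2)) := by
          gcongr
      _ = β * B := by field_simp
  calc |4 * π ^ 2 * (β * u1TopSusceptibility L β) - 1|
      = |(4 * π ^ 2 * (β * u1TopSusceptibility L β) - 4 * π ^ 2 * (β * c)) +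
          (4 * π ^ 2 * (β * c) - 1)| := by ring_nf
    _ ≤ |4 * π ^ 2 * (β * u1TopSusceptibility L β) - 4 * π ^ 2 * (β * c)| +
          |4 * π ^ 2 * (β * c) - 1| := abs_add_le _ _
    _ ≤ β * B + (2 / β + 2 * (9 / 10 * Real.exp (-3) * π ^ 7 * Real.sqrt π) / β ^ 2) :=
        add_le_add h1 hwc
    _ = _ := by ring

/-- **At finite volume, numeric constants**: for `L ≥ 2`, `β ≥ 2`,
`|4π² β χ_t(L, β) − 1| ≤ 2/β + 480/β² + β (L²+3) e^{3β} (I₁(β)/I₀(β))^{L²−3}`. -/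
theorem abs_beta_mul_u1TopSusceptibility_sub_le' {β : ℝ} (hβ : 2 ≤ β) (hL : 2 ≤ L) :
    |4 * π ^ 2 * (β * u1TopSusceptibility L β) - 1| ≤
      2 / β + 480 / β ^ 2 +
        β * (((L : ℝ) ^ 2 + 3) * Real.exp (3 * β) * (besselI 1 β / besselI 0 β) ^ (L ^ 2 - 3)) := by
  refine (abs_beta_mul_u1TopSusceptibility_sub_le hβ hL).trans ?_
  have hβ0 : 0 < β := by linarith
  have h := weakCouplingConst_le
  have : 2 * (9 / 10 * Real.exp (-3) * π ^ 7 * Real.sqrt π) / β ^ 2 ≤ 480 / β ^ 2 :=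
    div_le_div_of_nonneg_right (by linarith) (by positivity)
  linarith

end Summit.Ventures.LatticeQCDFlow.Scoring
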